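import Summits.QuantumFields.YangMills.Theorems.AlphaInputsT3ACv3NewtonShell
import Summits.QuantumFields.YangMills.Theorems.AlphaInputsT3ACv3LinearLiftMatrixCLMSub
import HarnessLib

/-!
# `AlphaInputsT3ACv3NewtonShellRegional` — STRATEGY B for 2′, the (FL) row under OWNER RULING g24-№4 («(FL) ⇐ `hLift` ⇐ Newton∕IFT on the (LL) engine»), residual
# (r1-shell): **THE NEWTON SHELL ON SUPPORTS** — the zero of a defect map on a SET `C` of constrained coarse bonds (e.g. `C = bondsIn k Ω_{k+1}(h)`), with hypotheses stated
# COMPONENTWISE on `c ∈ C` only and in the PLAIN one-form currency (no subtypes for the consumer), the kernel `R` ABSTRACT — lane `pub-balaban3d` ∕ cell `ym3-torus`,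
# seat `ym-ust-19936-w4` (g2)

WHY (cell `ym3-torus` STATUS 2026-08-28: ★★OWNER g25 02:16:33Z row table «(r1-curl)∕(r1-T)∕(r1-shell) → ★w4 + ★w3», 02:29:28Z «w4-19936 successor → (r1-shell)∕(r1-T)»; ★w1-19936 g2
LEAD memo v3 `NONABELIAN-FL-START-w1-g2.md` §2 «ONE global shell with transport frames … (r1-shell) the shell on `E_Ω` (w3's `piSub` pattern)»).  The model Newton lift
`NewtonLiftFlat.exists_exact_lift_flat(_allL)` (this seat, g0) runs the abstract shell `NewtonShell.exists_zero_in_range_of_approxRightInverse` on the WHOLE torus: Banach pair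
`E = piSub 𝔰𝔲 0`, `G = piSub 𝔰𝔲 k`, exact right inverse (`κ = 0`).  The REGIONAL lift the binder `hLift` of `…v3InnerLiftFromRegionalThm1` asks for constrains the `k`-fold
averages only on the coarse bonds `C = bondsIn k Ω` of the region, reads the candidate only through local stencil gauges, and its kernel is the TWISTED lift `liftSMTw k ψ` (★w3) —
possibly truncated, possibly with the «hole» of the cone device (★★OWNER 02:30:53Z) — whose exactness is only APPROXIMATE (`‖T(Ru)(c) − u(c)‖ ≤ κ‖u‖`, ★w3's
`norm_linAvgIterM_liftSMTw_sub_le`).  The assembly therefore needs the shell in the following currency, supplied here ONCE so that no consumer touches subtypes: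
* the unknown `u` is an `S`-valued level-`k` one-form SUPPORTED ON `C` (`u c = 0` off `C`), the correction is `R₀ u` for an ABSTRACT `ℝ`-linear kernel `R₀` on plain one-forms;
* the defect map `Φ₀` and the linearisation `T₀` are plain maps on plain one-forms, and EVERY hypothesis is asked only at the constrained bonds `c ∈ C`:
  (i) `‖Φ₀ x′ c − Φ₀ x c − T₀ (x′ − x) c‖ ≤ Κ‖x′ − x‖` on the sup-norm `r`-ball of `S`-valued finest one-forms, (ii) `‖T₀ (R₀ u) c − u c‖ ≤ κ‖u‖` for `u` supported on `C`,
  (iii) `‖R₀ u‖ ≤ ρ_R‖u‖`, (iv) `κ + Κρ_R < 1`, `ρ_R·ρ ≤ r`, (v) `‖Φ₀ 0 c‖ ≤ δ₀ ≤ (1 − κ − Κρ_R)·ρ`;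
* conclusion: `∃ u` `S`-valued, supported on `C`, `‖u‖ ≤ ρ`, `‖R₀ u‖ ≤ r`, `Φ₀ (R₀ u) c = 0` for every `c ∈ C`, and `‖u‖ ≤ δ₀ ∕ (1 − κ − Κρ_R)`.
WHAT (def-free).  ★★ `exists_zero_on_support_of_approxRightInverse` — the statement above.  Proof: the Banach pair `E := ↥(piSub P S 0)` (★w3's `…LinearLiftMatrixCLMSub`) and
`G_C := ↥(piSub P S k ⊓ Submodule.pi Cᶜ ⊥)` (finite dimension ⇒ complete); `T := 𝟙_C·T₀`, `R := R₀` restricted∕corestricted as continuous linear maps (`LinearMap.toContinuousLinearMap`);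
`Φ := 𝟙_C·Φ₀` on the `r`-ball (and `0` outside, never visited); `‖R‖ ≤ ρ_R` (`ContinuousLinearMap.opNorm_le_bound`); then `exists_zero_in_range_of_approxRightInverse` and the
extraction of the plain one-form with its support, sizes and the vanishing of `Φ₀ (R₀ u)` on `C`.  `norm_indicator_apply_le` — the one sup-norm letter used.
HONEST FRAMING.  Finite-dimensional functional analysis; no lattice estimate; the frames, the linearisation row (r1-T), the START and the plaquette ledger are NOT here; (FL)∕`hLift`,
the stub 2′χ, the crux `HistoryTailL` and any gap are NOT claimed; count-neutral helper toward R3 2′ (items 19936∕19935); registry untouched; nothing about d = 4, the continuum,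
or a mass gap; YM₃ on T³ is rung R3 of the programme, not the Clay problem.

References: L. M. Graves, Duke Math. J. 17 (1950) 111–114 (surjectivity behind `ApproximatesLinearOn`); T. Bałaban, Commun. Math. Phys. 102 (1985) 277–309 [Balaban1985Variational]
(Thm 1 (8) p.279, (11)–(14) pp.279–280: the regular exact lift on a region this shell serves); Commun. Math. Phys. 109 (1987) 249–301 [Balaban1987RG1] ((0.4), (0.11) p.253).
-/

set_option autoImplicit false

noncomputable section

open scoped Matrix.Norms.L2Operator
open Metric Set

namespace Summit.QuantumFields.YangMills.Theorems.NewtonShell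

open Literature.MathematicalPhysics.QuantumFieldTheory.Balaban1983to89
open Literature.MathematicalPhysics.QuantumFieldTheory.Balaban1985CMP102.Setting
open Summit.QuantumFields.Balaban3D.Carriers
open Summit.QuantumFields.YangMills.Theorems.LinearLiftMatrix (piSub mem_piSub completeSpace_piSub)

variable {P : Params} {n : Type*} [Fintype n] [DecidableEq n]

/-! ## §1 One sup-norm letter -/

omit [Fintype n] [DecidableEq n] in
/-- A component of the `C`-cut-off of a one-form is bounded by the corresponding component of the one-form, hence by any bound on it. [folklore] -/
theorem norm_indicator_apply_le {ι : Type*} {V : Type*} [SeminormedAddCommGroup V] (C : Set ι) (f : ι → V) (c : ι) {M : ℝ} (hM : 0 ≤ M)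
    (h : c ∈ C → ‖f c‖ ≤ M) : ‖C.indicator f c‖ ≤ M := by
  by_cases hc : c ∈ C
  · rw [indicator_of_mem hc]; exact h hc
  · rw [indicator_of_notMem hc, norm_zero]; exact hM

/-! ## §2 The shell on supports, plain currency -/

/-- **★★ THE NEWTON SHELL ON SUPPORTS (plain one-form currency, componentwise hypotheses on the constrained set).**  `S` an `ℝ`-submodule of `M_n(ℂ)` (e.g. `𝔰𝔲(n)`), `C` a set of
level-`k` bonds (the constrained coarse bonds, e.g. `bondsIn k Ω`); `Φ₀` a map and `T₀`, `R₀` `ℝ`-linear maps on PLAIN one-forms; radii and constants `0 ≤ Κ, κ, ρ_R, ρ, δ₀`, `r`, with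
`κ + Κ·ρ_R < 1`, `ρ_R·ρ ≤ r`, `δ₀ ≤ (1 − (κ + Κρ_R))·ρ`.  Suppose: `T₀` and `R₀` preserve `S`-valuedness (for `R₀`: on inputs supported on `C`); `Φ₀ x c ∈ S` for `c ∈ C` and `S`-valued `x`
with `‖x‖ ≤ r`; (i) for `S`-valued `x, x′` in the sup-norm `r`-ball and `c ∈ C`, `‖Φ₀ x′ c − Φ₀ x c − T₀ (x′ − x) c‖ ≤ Κ·‖x′ − x‖`; (ii) for `S`-valued `u` supported on `C` and `c ∈ C`,
`‖T₀ (R₀ u) c − u c‖ ≤ κ·‖u‖`; (iii) for such `u`, `‖R₀ u‖ ≤ ρ_R·‖u‖`; (v) `‖Φ₀ 0 c‖ ≤ δ₀` on `C`.  THEN there is an `S`-valued level-`k` one-form `u` SUPPORTED ON `C` with `‖u‖ ≤ ρ`,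
`‖R₀ u‖ ≤ r`, `Φ₀ (R₀ u) c = 0` for every `c ∈ C`, and `‖u‖ ≤ δ₀ ∕ (1 − (κ + Κρ_R))`.  (Banach fixed point on `G_C = ↥(piSub S k ⊓ pi Cᶜ ⊥)` for `u ↦ u − 𝟙_C·Φ₀(R₀ u)`, via
`exists_zero_in_range_of_approxRightInverse`; the kernel `R₀` is abstract: twisted lifts, truncations and holed kernels alike.) [folklore] -/
theorem exists_zero_on_support_of_approxRightInverse (S : Submodule ℝ (Matrix n n ℂ)) {k : ℕ} (C : Set (PBond P k))
    (Φ₀ : (PBond P 0 → Matrix n n ℂ) → PBond P k → Matrix n n ℂ)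
    (T₀ : (PBond P 0 → Matrix n n ℂ) →ₗ[ℝ] (PBond P k → Matrix n n ℂ))
    (R₀ : (PBond P k → Matrix n n ℂ) →ₗ[ℝ] (PBond P 0 → Matrix n n ℂ))
    {r Κ κ ρR ρ δ₀ : ℝ} (hΚ : 0 ≤ Κ) (hκ : 0 ≤ κ) (hρR : 0 ≤ ρR) (hq : κ + Κ * ρR < 1) (hρ : 0 ≤ ρ) (hρr : ρR * ρ ≤ r)
    (hδ₀ : 0 ≤ δ₀) (hδρ : δ₀ ≤ (1 - (κ + Κ * ρR)) * ρ)
    (hT : ∀ x : PBond P 0 → Matrix n n ℂ, (∀ b, x b ∈ S) → ∀ c, T₀ x c ∈ S)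
    (hR : ∀ u : PBond P k → Matrix n n ℂ, (∀ c, u c ∈ S) → (∀ c, c ∉ C → u c = 0) → ∀ b, R₀ u b ∈ S)
    (hΦS : ∀ x : PBond P 0 → Matrix n n ℂ, (∀ b, x b ∈ S) → ‖x‖ ≤ r → ∀ c ∈ C, Φ₀ x c ∈ S)
    (hlin : ∀ x x' : PBond P 0 → Matrix n n ℂ, (∀ b, x b ∈ S) → (∀ b, x' b ∈ S) → ‖x‖ ≤ r → ‖x'‖ ≤ r →
      ∀ c ∈ C, ‖Φ₀ x' c - Φ₀ x c - T₀ (x' - x) c‖ ≤ Κ * ‖x' - x‖)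
    (hinv : ∀ u : PBond P k → Matrix n n ℂ, (∀ c, u c ∈ S) → (∀ c, c ∉ C → u c = 0) → ∀ c ∈ C, ‖T₀ (R₀ u) c - u c‖ ≤ κ * ‖u‖)
    (hRn : ∀ u : PBond P k → Matrix n n ℂ, (∀ c, u c ∈ S) → (∀ c, c ∉ C → u c = 0) → ‖R₀ u‖ ≤ ρR * ‖u‖)
    (h0 : ∀ c ∈ C, ‖Φ₀ 0 c‖ ≤ δ₀) :
    ∃ u : PBond P k → Matrix n n ℂ, (∀ c, u c ∈ S) ∧ (∀ c, c ∉ C → u c = 0) ∧ ‖u‖ ≤ ρ ∧ ‖R₀ u‖ ≤ r ∧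
      (∀ c ∈ C, Φ₀ (R₀ u) c = 0) ∧ ‖u‖ ≤ δ₀ / (1 - (κ + Κ * ρR)) := by
  classical
  -- the Banach pair
  set GC : Submodule ℝ (PBond P k → Matrix n n ℂ) := piSub P S k ⊓ Submodule.pi Cᶜ (fun _ => ⊥) with hGC
  have memGC : ∀ u : PBond P k → Matrix n n ℂ, u ∈ GC ↔ (∀ c, u c ∈ S) ∧ (∀ c, c ∉ C → u c = 0) := by
    intro u
    rw [hGC, Submodule.mem_inf, mem_piSub, Submodule.mem_pi]
    refine and_congr Iff.rfl ⟨fun h c hc => ?_, fun h c hc => ?_⟩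
    · exact (Submodule.mem_bot ℝ).1 (h c hc)
    · exact (Submodule.mem_bot ℝ).2 (h c hc)
  haveI : CompleteSpace ↥GC := FiniteDimensional.complete ℝ _
  haveI : CompleteSpace ↥(piSub P S 0) := completeSpace_piSub P S 0
  have hr0 : 0 ≤ r := le_trans (mul_nonneg hρR hρ) hρr
  -- membership letters
  have memE : ∀ x : ↥(piSub P S 0), ∀ b, (x : PBond P 0 → Matrix n n ℂ) b ∈ S := fun x => (mem_piSub P S).1 x.2
  have memG1 : ∀ u : ↥GC, ∀ c, (u : PBond P k → Matrix n n ℂ) c ∈ S := fun u => ((memGC _).1 u.2).1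
  have memG2 : ∀ u : ↥GC, ∀ c, c ∉ C → (u : PBond P k → Matrix n n ℂ) c = 0 := fun u => ((memGC _).1 u.2).2
  have indMem : ∀ f : PBond P k → Matrix n n ℂ, (∀ c ∈ C, f c ∈ S) → C.indicator f ∈ GC := by
    intro f hf
    refine (memGC _).2 ⟨fun c => ?_, fun c hc => indicator_of_notMem hc _⟩
    by_cases hc : c ∈ C
    · rw [indicator_of_mem hc]; exact hf c hc
    · rw [indicator_of_notMem hc]; exact S.zero_mem
  -- `T := 𝟙_C · T₀` between the subtypes
  let Tl : ↥(piSub P S 0) →ₗ[ℝ] ↥GC :=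
    { toFun := fun x => ⟨C.indicator (T₀ (x : PBond P 0 → Matrix n n ℂ)), indMem _ fun c _ => hT _ (memE x) c⟩
      map_add' := fun x y => by
        apply Subtype.ext
        show C.indicator (T₀ ((x : PBond P 0 → Matrix n n ℂ) + (y : PBond P 0 → Matrix n n ℂ))) =
          C.indicator (T₀ (x : PBond P 0 → Matrix n n ℂ)) + C.indicator (T₀ (y : PBond P 0 → Matrix n n ℂ))
        rw [map_add, indicator_add']
      map_smul' := fun a x => by
        apply Subtype.ext
        show C.indicator (T₀ (a • (x : PBond P 0 → Matrix n n ℂ))) = a • C.indicator (T₀ (x : PBond P 0 → Matrix n n ℂ))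
        rw [map_smul]
        funext c
        by_cases hc : c ∈ C
        · rw [indicator_of_mem hc, Pi.smul_apply, Pi.smul_apply, indicator_of_mem hc]
        · rw [indicator_of_notMem hc, Pi.smul_apply, indicator_of_notMem hc, smul_zero] }
  let T : ↥(piSub P S 0) →L[ℝ] ↥GC := LinearMap.toContinuousLinearMap Tl
  have hTapp : ∀ x : ↥(piSub P S 0), ((T x : ↥GC) : PBond P k → Matrix n n ℂ) = C.indicator (T₀ (x : PBond P 0 → Matrix n n ℂ)) := fun x => rfl
  -- `R := R₀` between the subtypes
  let Rl : ↥GC →ₗ[ℝ] ↥(piSub P S 0) :=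
    { toFun := fun u => ⟨R₀ (u : PBond P k → Matrix n n ℂ), (mem_piSub P S).2 (hR _ (memG1 u) (memG2 u))⟩
      map_add' := fun u v => by apply Subtype.ext; exact map_add R₀ _ _
      map_smul' := fun a u => by apply Subtype.ext; exact map_smul R₀ _ _ }
  let R : ↥GC →L[ℝ] ↥(piSub P S 0) := LinearMap.toContinuousLinearMap Rl
  have hRapp : ∀ u : ↥GC, ((R u : ↥(piSub P S 0)) : PBond P 0 → Matrix n n ℂ) = R₀ (u : PBond P k → Matrix n n ℂ) := fun u => rfl
  have hRop : ‖R‖ ≤ ρR := by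
    refine ContinuousLinearMap.opNorm_le_bound _ hρR fun u => ?_
    rw [← Submodule.norm_coe, hRapp, ← Submodule.norm_coe]
    exact hRn _ (memG1 u) (memG2 u)
  -- `Φ := 𝟙_C · Φ₀` on the `r`-ball
  let Φ : ↥(piSub P S 0) → ↥GC := fun x =>
    if h : ‖x‖ ≤ r then ⟨C.indicator (Φ₀ (x : PBond P 0 → Matrix n n ℂ)), indMem _ fun c hc => hΦS _ (memE x) (by rwa [Submodule.norm_coe]) c hc⟩ else 0
  have hΦapp : ∀ x : ↥(piSub P S 0), ‖x‖ ≤ r → ((Φ x : ↥GC) : PBond P k → Matrix n n ℂ) = C.indicator (Φ₀ (x : PBond P 0 → Matrix n n ℂ)) := by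
    intro x hx
    show (((if h : ‖x‖ ≤ r then ⟨C.indicator (Φ₀ (x : PBond P 0 → Matrix n n ℂ)), indMem _ fun c hc => hΦS _ (memE x) (by rwa [Submodule.norm_coe]) c hc⟩ else 0 : ↥GC)) :
      PBond P k → Matrix n n ℂ) = _
    rw [dif_pos hx]
  -- hypothesis (i) of the abstract shell
  have hΦ : ∀ x ∈ closedBall (0 : ↥(piSub P S 0)) r, ∀ x' ∈ closedBall (0 : ↥(piSub P S 0)) r, ‖Φ x' - Φ x - T (x' - x)‖ ≤ Κ * ‖x' - x‖ := by
    intro x hx x' hx'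
    rw [mem_closedBall_zero_iff] at hx hx'
    have hxr : ‖(x : PBond P 0 → Matrix n n ℂ)‖ ≤ r := by rw [Submodule.norm_coe]; exact hx
    have hxr' : ‖(x' : PBond P 0 → Matrix n n ℂ)‖ ≤ r := by rw [Submodule.norm_coe]; exact hx'
    have hnn : 0 ≤ Κ * ‖x' - x‖ := mul_nonneg hΚ (norm_nonneg _)
    have hdiff : ‖(x' : PBond P 0 → Matrix n n ℂ) - (x : PBond P 0 → Matrix n n ℂ)‖ = ‖x' - x‖ := by rw [← Submodule.coe_sub, Submodule.norm_coe]
    rw [← Submodule.norm_coe, Submodule.coe_sub, Submodule.coe_sub, hΦapp x hx, hΦapp x' hx', hTapp, Submodule.coe_sub]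
    refine (pi_norm_le_iff_of_nonneg hnn).2 fun c => ?_
    rw [Pi.sub_apply, Pi.sub_apply]
    by_cases hc : c ∈ C
    · rw [indicator_of_mem hc, indicator_of_mem hc, indicator_of_mem hc, ← hdiff]
      exact hlin _ _ (memE x) (memE x') hxr hxr' c hc
    · rw [indicator_of_notMem hc, indicator_of_notMem hc, indicator_of_notMem hc, sub_zero, sub_zero, norm_zero]
      exact hnn
  -- hypothesis (ii)
  have hRinv : ∀ u : ↥GC, ‖T (R u) - u‖ ≤ κ * ‖u‖ := by
    intro u
    rw [← Submodule.norm_coe, Submodule.coe_sub, hTapp, hRapp]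
    refine (pi_norm_le_iff_of_nonneg (mul_nonneg hκ (norm_nonneg _))).2 fun c => ?_
    rw [Pi.sub_apply]
    by_cases hc : c ∈ C
    · rw [indicator_of_mem hc, ← Submodule.norm_coe]
      exact hinv _ (memG1 u) (memG2 u) c hc
    · rw [indicator_of_notMem hc, memG2 u c hc, sub_zero, norm_zero]
      exact mul_nonneg hκ (norm_nonneg _)
  -- (iii)–(v)
  have hq' : κ + Κ * ‖R‖ < 1 := lt_of_le_of_lt (by gcongr) hq
  have hρr' : ‖R‖ * ρ ≤ r := (mul_le_mul_of_nonneg_right hRop hρ).trans hρr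
  have hΦ0 : ‖Φ 0‖ ≤ δ₀ := by
    rw [← Submodule.norm_coe, hΦapp 0 (by rw [norm_zero]; exact hr0), Submodule.coe_zero]
    refine (pi_norm_le_iff_of_nonneg hδ₀).2 fun c => norm_indicator_apply_le C _ c hδ₀ fun hc => h0 c hc
  have h1q : 1 - (κ + Κ * ρR) ≤ 1 - (κ + Κ * ‖R‖) := by gcongr
  have h0' : ‖Φ 0‖ ≤ (1 - (κ + Κ * ‖R‖)) * ρ := hΦ0.trans (hδρ.trans (mul_le_mul_of_nonneg_right h1q hρ))
  -- THE SHELL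
  obtain ⟨u, huρ, hΦu, hub⟩ := exists_zero_in_range_of_approxRightInverse Φ T R hΦ hRinv hκ hΚ hq' hρ hρr' h0'
  have hRu : ‖R u‖ ≤ r := (R.le_opNorm u).trans ((mul_le_mul_of_nonneg_left huρ (norm_nonneg _)).trans hρr')
  refine ⟨(u : PBond P k → Matrix n n ℂ), memG1 u, memG2 u, by rwa [Submodule.norm_coe], ?_, fun c hc => ?_, ?_⟩
  · rwa [← hRapp, Submodule.norm_coe]
  · have h := congrArg (fun v : ↥GC => (v : PBond P k → Matrix n n ℂ) c) hΦu
    rw [hΦapp (R u) hRu, hRapp, indicator_of_mem hc, Submodule.coe_zero, Pi.zero_apply] at h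
    exact h
  · rw [Submodule.norm_coe]
    exact hub.trans (div_le_div₀ hδ₀ hΦ0 (by linarith) h1q)

end Summit.QuantumFields.YangMills.Theorems.NewtonShell

end
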